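/-
Copyright: lit-balaban Phase-2 proof seat p30 (gen 9).  Statement-level skeleton of a published paper; no proof claims beyond what
the kernel checks below.
-/
import Literature.MathematicalPhysics.QuantumFieldTheory.BalabanImbrieJaffe1984to88.BIJ85UnitTorusHodge
import Literature.MathematicalPhysics.QuantumFieldTheory.BalabanImbrieJaffe1984to88.BIJ85ResidualExact
import Literature.MathematicalPhysics.QuantumFieldTheory.BalabanImbrieJaffe1984to88.BIJ85ResidualConstants
import Literature.MathematicalPhysics.QuantumFieldTheory.BalabanImbrieJaffe1984to88.BIJ85Claim73Closed

/-!
# [BalabanImbrieJaffe1985] §7.3: the residual field `f_k` of a CLOSED unit field is uniformly bounded — `K_R` from the ∇H member of (7.2.2)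

T. Bałaban, J. Imbrie, A. Jaffe, *Renormalization of the Higgs model: minimizers, propagators and the stability of mean field theory*,
Commun. Math. Phys. **97** (1985) 299–329 [BalabanImbrieJaffe1985].  Row **C1.Eq7.3.1-7.3.2** of the lit-balaban skeleton: the residual
link of the row — the located input `K_R` of p33's `BIJ85Claim73Residual` (*"|f_k(p)| ≤ K_R·max|f|"* for the field (4.2.6)
`f_k = (I − ∂G_{k,Ax}∂^*)Q^{e*}_kf` of the actual background (4.5.4), `u_k(∂p) = exp(ie_kη²f_k(p))`, p33's `BIJ85Eq454PlaqResidual`) —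
DISCHARGED from the ∇H member of (7.2.2) for every CLOSED unit-lattice plaquette field `f`, with `K_R` depending only on `d` and on the
constants `M, δ` of (7.2.2): uniform in the scale `k ≤ m + K`, in the volume and in the field.

THE PRINTED TEXT, verbatim, p. 326 [PDF 28]: *"Let us assume that the field strength satisfies |f| = |(ie_k)^{−1}log v(∂p)| < 𝓅(e_k), (7.3.1) …
These bounds follow from (7.2.2–4). In fact (7.3.1) ensures that |u_k(∂p) − 1| ≤ O(1)𝓅(e_k)e_kη² for every η-lattice plaquette p … Also, by
change of gauge u_k can be transformed in a local region Λ into a configuration of the form exp[ie_kηA], where A is smooth and small with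
estimates depending on Λ."*

THE PROOF (as printed, made explicit).  A closed unit field on the torus `T^{(k)}` is its flux part plus a curl, `f = h + ∂B`, the
potential `B` in the gauge of p. 326: small near the block `x_k(p)` of the η-plaquette under consideration and of quadratic growth away from
it, `|B(b)| ≤ (8d+2)max|f|·(1 + |b₋ − x_k(p)|₁)²` (`BIJ85UnitTorusHodge.exists_const_add_curl_of_closed`, the volume-uniform discrete Poincaré
lemma `TorusChartCurlPrimitiveGrowth`).  On the flux part `f_k = h` exactly (`BIJ85ResidualConstants.resE_const`); on the curl
`f_k = ∂^ηH_kB` ((6.1.5) of [BalabanImbrieJaffe1988], p33 `BIJ85ResidualMinimizer.resE_dOne_eq_curlOp_HkE`), whose kernel (7.2.1) obeys the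
∇H member of (7.2.2), `|(∂^ηH_ke_b)(p)| ≤ Me^{−δ|x_k(p) − b₋|₁}` (p08 `BIJ88Ineq217Ineq722Torus.exists_hK_of_ineq722` from r15's typed
`KernelData.Ineq722`), so `|f_k(p)| ≤ max|h| + Σ_b Me^{−δ|x_k(p)−b₋|₁}|B(b)| ≤ (1 + (8d+2)M(1+4/δ)²d(2(1+2/δ))^d)·max|f|`
(`BIJ85ResidualExact.abs_resE_dOne_le_of_growth`).

WHAT IS PROVED (0 `sorry`, theorems only, no `def`, no new named fact).
* **`abs_resE_le_of_closed`** — one torus, one scale `k ≤ m + K` (`2 ≤ d`, `w > 0`, curl factor `c = L^k = η⁻¹`): the kernel shape of the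
  ∇H member of (7.2.2) gives, for EVERY CLOSED `f : Plaq P k → ℝ` with `|f| ≤ s`, `|resE(f)(p)| ≤ √w·(1 + (8d+2)M(1+4/δ)²d(2(1+2/δ))^d)·s`;
  `abs_resE_le_of_closed_eta` — the same at `c = η⁻¹`, `w = η^d` (p33's normalisation `ResIdx.hR`, restricted to closed `f`).
* **`exists_KR_of_ineq722`** — the family version: from r15's typed (7.2.2) `KernelData.Ineq722` for p09's torus kernel family
  `j ↦ torusKernelData P (lev j) (deltaAData …) …`, ONE constant `K_R` serves every scale `lev j ≤ m + K`, every `w > 0`, every closed `f`.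
* **`exists_KR_of_prop12Printed`** — the same GIVEN ONLY [6I] Proposition 1.2 by its tree name `B5.Prop12Printed` for the torus carriers
  (`BIJ85Ineq722DeltaA.ineq722_deltaA_of_prop12Printed`).
* §3 **THE INDEX OF p33's `BIJ85Claim73Closed` IS TOTAL**: `altExt = plaqCoch` (the two closedness readings agree definitionally), the located
  input `ClosedIdx.hR` in the `ofD₂` form from the kernel shape (`hbound_of_kernel`), and **`closedIdx_total_of_ineq722`** /
  **`closedIdx_total_of_prop12Printed`**: ONE `K_R` such that EVERY actual datum (torus `P`, scale `1 ≤ k = lev j ≤ m + K`, coupling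
  `0 < e_k ≤ 1` with `e_k𝓅(e_k) ≤ ½`, ANY unit field `v`) is an index of `ClosedIdx d K_R 𝓅` — so p33's `claim73_closed : Claim73 𝓅 (closedStabData …)`
  speaks about all of them: (7.3.1) ⇒ (7.3.2) for the ACTUAL background (4.5.4), given the typed (7.2.2) (resp. [6I] Prop. 1.2) only.
HONEST SCOPE.  (i) CLOSED unit fields only — necessarily: for a non-closed `f` (a single unit plaquette, `d ≥ 3`) the co-closed component of
`Q^{e*}_kf` is not cancelled and `max|resE(f)| ≥ √w·L^{2k}/(2d)·max|f|`; the field `f^{(k)} = (ie_k)^{−1}log v(∂·)` of a `v` under (7.3.1) is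
closed by the abelian Bianchi identity as soon as `6𝓅(e_k) < 2π/e_k`.  (ii) First printed form; `U = 1` real abelian fields; torus; standing
range; constants explicit, not optimised.  statement-level skeleton of published theorems with citation tags; proofs where landed; nothing here
is a claim about the Yang–Mills mass gap.  Unit `lit-balaban-p30` (literature-prover-lit-balaban-p30-g9-0), 2026-08-21.
-/

open scoped BigOperators RealInnerProductSpace

namespace Literature.MathematicalPhysics.QuantumFieldTheory.BalabanImbrieJaffe1984to88.BIJ85ResidualSupBound

open Balaban1983to89 hiding Site Plaq
open Balaban1983to89.LatticeFieldCalculus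
open BIJ85AxialPropagator411 BIJ85Prop521Torus BIJ85Sigma421Torus BIJ85Eq611Torus BIJ85Prop522Torus BIJ85Sigma422Eta
open BIJ85Sect7Statements BIJ85Ineq722Torus
open BIJ85Ineq722ProofPart2 (settingOf)
open BIJ85Ineq722DeltaA (deltaAData ineq722_deltaA_of_prop12Printed)
open BIJ85Eq454PlaqResidual (resE)
open BIJ85GaugeFunction5113 (blk)
open BIJ88Ineq217Ineq722Torus (exists_hK_of_ineq722)
open BIJ85UnitTorusHodge (plaqCoch IsClosedPlaq exists_const_add_curl_of_closed)
open BIJ85Sect1Model (U1Field)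
open BIJ85Claim73Closed (altExt ClosedIdx)
open B5Positivity172Lattice (chart)
open BIJ85ResidualExact (abs_resE_dOne_le_of_growth)
open BIJ85ResidualConstants (abs_resE_const_le)
-- inside this namespace the bare `Site`/`Plaq` are the `ℤ^d` carriers of the QFT root; the torus ones are renamed:
open Balaban1983to89 renaming Site → TSite, Plaq → TPlaq

noncomputable section

variable {P : Params}

/-! ## §1  One torus, one scale -/

/-- `resE` is additive in the unit field (it is a composite of linear maps). [cite: BalabanImbrieJaffe1985, (4.2.6) p.311] -/
theorem resE_add (hd : 2 ≤ P.d) (w c : ℝ) (k : ℕ) (F G : UnitPlaqSpace P k) :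
    resE hd w c k (F + G) = resE hd w c k F + resE hd w c k G := by
  simp only [resE, map_add]
  abel

/-- `dOne` at curl factor `c = L^k` is the UNIT curl `∂₁`: `dOne P k L^k (ι B) = ι(∂₁B)`. [cite: BalabanImbrieJaffe1985, (6.4) p.318] -/
theorem dOne_pow_toEj (k : ℕ) (B : PBond P k → ℝ) :
    dOne P k ((P.L : ℝ) ^ k) (toEj P k B) = toU P k (curl 1 B) := by
  rw [dOne_toEj, div_self (pow_ne_zero _ P.cast_L_pos.ne')]

/-- **THE RESIDUAL FIELD OF A CLOSED UNIT FIELD IS UNIFORMLY BOUNDED** (one torus, one scale `k ≤ m + K`, `2 ≤ d`, `w > 0`, curl factor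
`c = L^k = η⁻¹`): if the kernel of `∂^{c}H_k` obeys the shape of the ∇H member of (7.2.2), `|(∂^{c}H_ke_b)(p)| ≤ Me^{−δ|x_k(p) − b₋|₁}`
(`M ≥ 0`, `δ > 0`), then for every CLOSED unit plaquette field `f` with `|f(q)| ≤ s` and every η-plaquette `p`,
`|resE(f)(p)| ≤ √w·(1 + (8d+2)·M·(1+4/δ)²·d·(2(1+2/δ))^d)·s` — flux part `h` exactly, curl part in the gauge of p. 326 through the kernel.
[cite: BalabanImbrieJaffe1985, (7.3.2) p.326] -/
theorem abs_resE_le_of_closed (hd : 2 ≤ P.d) {k : ℕ} (hk : k ≤ P.m + P.K) {w : ℝ} (hw : 0 < w) {M δ : ℝ} (hM : 0 ≤ M) (hδ : 0 < δ)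
    (hK : ∀ (p : TPlaq P 0) (b : PBond P k),
      |curl ((P.L : ℝ) ^ k) (WithLp.ofLp (HkE P w ((P.L : ℝ) ^ k) k (toEj P k (Pi.single b 1)))) p| ≤
        M * Real.exp (-δ * ((blk k p.src).tdist b.src : ℝ)))
    {f : TPlaq P k → ℝ} (hf : IsClosedPlaq f) {s : ℝ} (hs0 : 0 ≤ s) (hs : ∀ q, |f q| ≤ s) (p : TPlaq P 0) :
    |resE hd w ((P.L : ℝ) ^ k) k (toU P k f) p| ≤
      Real.sqrt w * (1 + (8 * P.d + 2) * M * ((1 + 4 / δ) ^ 2 * ((P.d : ℝ) * (2 * (1 + (δ / 2)⁻¹)) ^ P.d))) * s := by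
  have hc : ((P.L : ℝ) ^ k) ≠ 0 := pow_ne_zero _ P.cast_L_pos.ne'
  -- the gauge of p. 326 based at the block `x_k(p)`: `f = h + ∂₁B`
  obtain ⟨h, B, hh, -, -, hdec, hB⟩ := exists_const_add_curl_of_closed hf hs0 hs (blk k p.src)
  have hsplit : toU P k f = toU P k (fun q : TPlaq P k => h q.μ q.ν) + dOne P k ((P.L : ℝ) ^ k) (toEj P k B) := by
    rw [dOne_pow_toEj, ← map_add]
    congr 1
    funext q
    exact hdec q
  rw [hsplit, resE_add]
  have h1 := abs_resE_const_le hd hk hc hw hh p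
  have hCB : 0 ≤ (8 * (P.d : ℝ) + 2) * s := by positivity
  have h2 := abs_resE_dOne_le_of_growth hd hk hc hw hM hδ hK p hCB hB
  calc |resE hd w ((P.L : ℝ) ^ k) k (toU P k fun q : TPlaq P k => h q.μ q.ν) p +
          resE hd w ((P.L : ℝ) ^ k) k (dOne P k ((P.L : ℝ) ^ k) (toEj P k B)) p|
      ≤ Real.sqrt w * s + Real.sqrt w * (M * ((8 * (P.d : ℝ) + 2) * s) *
          ((1 + 4 / δ) ^ 2 * ((P.d : ℝ) * (2 * (1 + (δ / 2)⁻¹)) ^ P.d))) := (abs_add_le _ _).trans (add_le_add h1 h2)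
    _ = _ := by ring

/-- **The same in p33's normalisation** `c = η⁻¹`, `w = η^d` (the field `hR` of `BIJ85Claim73Residual.ResIdx`, restricted to CLOSED unit
fields): `|resE(f)(p)| ≤ K·√(η^d)·s` with `K = 1 + (8d+2)M(1+4/δ)²d(2(1+2/δ))^d`. [cite: BalabanImbrieJaffe1985, (7.3.2) p.326] -/
theorem abs_resE_le_of_closed_eta (hd : 2 ≤ P.d) {k : ℕ} (hk : k ≤ P.m + P.K) {M δ : ℝ} (hM : 0 ≤ M) (hδ : 0 < δ)
    (hK : ∀ (p : TPlaq P 0) (b : PBond P k),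
      |curl ((P.L : ℝ) ^ k) (WithLp.ofLp (HkE P ((P.eta k) ^ P.d) ((P.L : ℝ) ^ k) k (toEj P k (Pi.single b 1)))) p| ≤
        M * Real.exp (-δ * ((blk k p.src).tdist b.src : ℝ)))
    {f : TPlaq P k → ℝ} (hf : IsClosedPlaq f) {s : ℝ} (hs0 : 0 ≤ s) (hs : ∀ q, |f q| ≤ s) (p : TPlaq P 0) :
    |resE hd ((P.eta k) ^ P.d) (P.eta k)⁻¹ k (toU P k f) p| ≤
      (1 + (8 * P.d + 2) * M * ((1 + 4 / δ) ^ 2 * ((P.d : ℝ) * (2 * (1 + (δ / 2)⁻¹)) ^ P.d))) *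
        Real.sqrt ((P.eta k) ^ P.d) * s := by
  rw [eta_inv, mul_comm (1 + _) (Real.sqrt _)]
  exact abs_resE_le_of_closed hd hk (pow_pos (eta_pos P k) _) hM hδ hK hf hs0 hs p

/-! ## §2  The family: one `K_R` for every scale, from the typed (7.2.2) -/

/-- **`K_R` FROM THE TYPED ROW C1.Eq7.2.1-7.2.2**: given r15's typed (7.2.2) `KernelData.Ineq722` for p09's torus kernel family
`j ↦ torusKernelData P (lev j) (deltaAData …) …` (scales `lev j ≤ m + K`), there is ONE constant `K_R ≥ 1` such that at EVERY scale
`k = lev j`, for every `w > 0`, every CLOSED unit plaquette field `f` with `|f| ≤ s` and every η-plaquette `p`: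
`|resE(f)(p)| ≤ √w·K_R·s` (curl factor `L^k`) — the located input of the residual route to (7.3.2), uniform in `k`, in the volume and in `f`.
[cite: BalabanImbrieJaffe1985, (7.3.2) p.326] -/
theorem exists_KR_of_ineq722 (hd : 2 ≤ P.d) {lev : ℕ → ℕ} (hlev : ∀ j, lev j ≤ P.m + P.K) {a : ℝ} (ha : 0 < a)
    {BondU : ℕ → Type} {distEB : (j : ℕ) → TSite P 0 → BondU j → ℝ}
    {Cker : (j : ℕ) → Fin P.d → Fin P.d → TSite P (lev j) → TSite P (lev j) → ℝ} {Dker : (j : ℕ) → TSite P 0 → BondU j → ℝ}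
    (h722 : KernelData.Ineq722
      (fun j => torusKernelData P (lev j) (deltaAData (hlev j) a) (BondU j) (distEB j) (Cker j) (Dker j))) :
    ∃ KR : ℝ, 1 ≤ KR ∧ ∀ (j : ℕ) (w : ℝ), 0 < w → ∀ (f : TPlaq P (lev j) → ℝ), IsClosedPlaq f → ∀ (s : ℝ), 0 ≤ s →
      (∀ q, |f q| ≤ s) → ∀ p : TPlaq P 0,
        |resE hd w ((P.L : ℝ) ^ lev j) (lev j) (toU P (lev j) f) p| ≤ Real.sqrt w * KR * s := by
  obtain ⟨M, δH, hM, hδH, hK⟩ := exists_hK_of_ineq722 hlev ha h722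
  refine ⟨1 + (8 * P.d + 2) * M * ((1 + 4 / δH) ^ 2 * ((P.d : ℝ) * (2 * (1 + (δH / 2)⁻¹)) ^ P.d)),
    le_add_of_nonneg_right (by positivity), ?_⟩
  intro j w hw f hf s hs0 hs p
  exact abs_resE_le_of_closed hd (hlev j) hw hM hδH
    (fun p b => hK j _ (pow_ne_zero _ P.cast_L_pos.ne') _ hw p b) hf hs0 hs p

/-- **`K_R` GIVEN ONLY [6I] PROPOSITION 1.2 BY ITS TREE NAME**: the same conclusion from `B5.Prop12Printed` for the torus carriers
`settingOf (torusRep P (lev j) (deltaAData …)) j` — row C1.Eq7.2.1-7.2.2's own derivation *"(7.2.2) is a consequence of Proposition 1.2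
and the representation (1.103) of [6I]"* (`BIJ85Ineq722DeltaA.ineq722_deltaA_of_prop12Printed`) feeding `exists_KR_of_ineq722`.
[cite: BalabanImbrieJaffe1985, (7.3.2) p.326] -/
theorem exists_KR_of_prop12Printed (hd : 2 ≤ P.d) {lev : ℕ → ℕ} (hlev : ∀ j, lev j ≤ P.m + P.K) {a : ℝ} (ha : 0 < a)
    (h12 : B5.Prop12Printed (fun j => settingOf (torusRep P (lev j) (deltaAData (hlev j) a)) j)) :
    ∃ KR : ℝ, 1 ≤ KR ∧ ∀ (j : ℕ) (w : ℝ), 0 < w → ∀ (f : TPlaq P (lev j) → ℝ), IsClosedPlaq f → ∀ (s : ℝ), 0 ≤ s →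
      (∀ q, |f q| ≤ s) → ∀ p : TPlaq P 0,
        |resE hd w ((P.L : ℝ) ^ lev j) (lev j) (toU P (lev j) f) p| ≤ Real.sqrt w * KR * s :=
  exists_KR_of_ineq722 hd hlev ha
    (ineq722_deltaA_of_prop12Printed lev hlev ha (fun _ => PUnit) (fun _ _ _ => 0) (fun _ _ _ _ _ => 0) (fun _ _ _ => 0) h12)

/-- **The family version in p33's normalisation** (`c = η⁻¹`, `w = η^d`): ONE `K_R` with `|resE(f)(p)| ≤ K_R·√(η^d)·s` at every scale of the
family, for every closed `f` with `|f| ≤ s` — the closed-field form of `BIJ85Claim73Residual.ResIdx.hR`, supplied from the typed (7.2.2).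
[cite: BalabanImbrieJaffe1985, (7.3.2) p.326] -/
theorem exists_KR_eta_of_ineq722 (hd : 2 ≤ P.d) {lev : ℕ → ℕ} (hlev : ∀ j, lev j ≤ P.m + P.K) {a : ℝ} (ha : 0 < a)
    {BondU : ℕ → Type} {distEB : (j : ℕ) → TSite P 0 → BondU j → ℝ}
    {Cker : (j : ℕ) → Fin P.d → Fin P.d → TSite P (lev j) → TSite P (lev j) → ℝ} {Dker : (j : ℕ) → TSite P 0 → BondU j → ℝ}
    (h722 : KernelData.Ineq722
      (fun j => torusKernelData P (lev j) (deltaAData (hlev j) a) (BondU j) (distEB j) (Cker j) (Dker j))) :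
    ∃ KR : ℝ, 1 ≤ KR ∧ ∀ (j : ℕ) (f : TPlaq P (lev j) → ℝ), IsClosedPlaq f → ∀ (s : ℝ), 0 ≤ s → (∀ q, |f q| ≤ s) →
      ∀ p : TPlaq P 0,
        |resE hd ((P.eta (lev j)) ^ P.d) (P.eta (lev j))⁻¹ (lev j) (toU P (lev j) f) p| ≤
          KR * Real.sqrt ((P.eta (lev j)) ^ P.d) * s := by
  obtain ⟨KR, hKR, h⟩ := exists_KR_of_ineq722 hd hlev ha h722
  refine ⟨KR, hKR, fun j f hf s hs0 hs p => ?_⟩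
  rw [eta_inv, mul_comm KR]
  exact h j _ (pow_pos (eta_pos P (lev j)) _) f hf s hs0 hs p

/-! ## §3  The index of `BIJ85Claim73Closed` is total -/

/-- The two alternating extensions of a plaquette field in the tree (p33's `altExt`, this seat's `plaqCoch`) are the same cochain, so the
two closedness readings `d₂ (altExt F) = 0` and `IsClosedPlaq F` agree. [cite: BalabanImbrieJaffe1985, (4.2.4) p.311] -/
theorem altExt_eq_plaqCoch {k : ℕ} (F : TPlaq P k → ℝ) : altExt F = plaqCoch F := rfl

/-- Plaquettes exist (`d ≥ 2`), so a bound `|F(q)| ≤ s` forces `0 ≤ s`. [cite: BalabanImbrieJaffe1985, (2.1) p.304] -/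
theorem nonneg_of_abs_le (hd : 2 ≤ P.d) {k : ℕ} {F : TPlaq P k → ℝ} {s : ℝ} (hs : ∀ q, |F q| ≤ s) : 0 ≤ s :=
  (abs_nonneg _).trans (hs ⟨fun _ => 0, ⟨0, by omega⟩, ⟨1, by omega⟩, by simp [Fin.lt_def]⟩)

/-- **The located input `ClosedIdx.hR` in p33's `ofD₂` form, from the kernel shape of the ∇H member of (7.2.2)** (one torus, one scale,
`w = η^d`, `c = η⁻¹ = L^k`): `∀ F, d₂ (altExt F) = 0 → |F| ≤ s → |resE(F)(p)| ≤ √(η^d)·K·s`, `K = 1 + (8d+2)M(1+4/δ)²d(2(1+2/δ))^d`.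
[cite: BalabanImbrieJaffe1985, (7.3.1) p.326] -/
theorem hbound_of_kernel (hd : 2 ≤ P.d) {k : ℕ} (hk : k ≤ P.m + P.K) {M δ : ℝ} (hM : 0 ≤ M) (hδ : 0 < δ)
    (hK : ∀ (p : TPlaq P 0) (b : PBond P k),
      |curl ((P.L : ℝ) ^ k) (WithLp.ofLp (HkE P ((P.eta k) ^ P.d) ((P.L : ℝ) ^ k) k (toEj P k (Pi.single b 1)))) p| ≤
        M * Real.exp (-δ * ((blk k p.src).tdist b.src : ℝ))) :
    ∀ F : TPlaq P k → ℝ, (chart P k).d₂ (altExt F) = 0 → ∀ s : ℝ, (∀ q, |F q| ≤ s) →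
      ∀ p : TPlaq P 0, |resE hd ((P.eta k) ^ P.d) (P.eta k)⁻¹ k (toU P k F) p| ≤
        Real.sqrt ((P.eta k) ^ P.d) * (1 + (8 * P.d + 2) * M * ((1 + 4 / δ) ^ 2 * ((P.d : ℝ) * (2 * (1 + (δ / 2)⁻¹)) ^ P.d))) * s := by
  intro F hF s hs p
  have hcl : IsClosedPlaq F := by rw [altExt_eq_plaqCoch] at hF; exact hF
  rw [eta_inv]
  exact abs_resE_le_of_closed hd hk (pow_pos (eta_pos P k) _) hM hδ hK hcl (nonneg_of_abs_le hd hs) hs p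

/-- **THE INDEX OF `BIJ85Claim73Closed` IS TOTAL, GIVEN THE TYPED (7.2.2)**: from r15's `KernelData.Ineq722` for p09's torus kernel family
(scales `lev j ≤ m + K`) there is ONE `K_R ≥ 1` such that for EVERY scale `1 ≤ lev j`, every coupling `0 < e ≤ 1` with `e𝓅(e) ≤ ½` and
EVERY unit-lattice `U(1)` field `v` on `T^{(lev j)}`, the datum `(P, lev j, e, v)` is an index of p33's `ClosedIdx d K_R 𝓅` — hence p33's
`claim73_closed` ((7.3.1) ⇒ (7.3.2) for the actual background (4.5.4)) covers all of them with this one `K_R`. [cite: BalabanImbrieJaffe1985, (7.3.2) p.326] -/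
theorem closedIdx_total_of_ineq722 (hd : 2 ≤ P.d) {lev : ℕ → ℕ} (hlev : ∀ j, lev j ≤ P.m + P.K) {a : ℝ} (ha : 0 < a)
    {BondU : ℕ → Type} {distEB : (j : ℕ) → TSite P 0 → BondU j → ℝ}
    {Cker : (j : ℕ) → Fin P.d → Fin P.d → TSite P (lev j) → TSite P (lev j) → ℝ} {Dker : (j : ℕ) → TSite P 0 → BondU j → ℝ}
    (h722 : KernelData.Ineq722
      (fun j => torusKernelData P (lev j) (deltaAData (hlev j) a) (BondU j) (distEB j) (Cker j) (Dker j))) (pexp : ℝ) :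
    ∃ KR : ℝ, 1 ≤ KR ∧ ∀ (j : ℕ), 1 ≤ lev j → ∀ (e : ℝ) (he : 0 < e) (he1 : e ≤ 1)
      (hsmall : e * (1 + Real.log e⁻¹) ^ pexp ≤ 1 / 2) (v : U1Field P (lev j)),
      ∃ i : ClosedIdx P.d KR pexp, i.P = P ∧ i.k = lev j ∧ i.e = e ∧ HEq i.v v := by
  obtain ⟨M, δH, hM, hδH, hK⟩ := exists_hK_of_ineq722 hlev ha h722
  refine ⟨1 + (8 * P.d + 2) * M * ((1 + 4 / δH) ^ 2 * ((P.d : ℝ) * (2 * (1 + (δH / 2)⁻¹)) ^ P.d)),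
    le_add_of_nonneg_right (by positivity), ?_⟩
  intro j hj e he he1 hsmall v
  exact ⟨ClosedIdx.ofD₂ P rfl hd (lev j) hj (hlev j) e he he1 hsmall v
    (hbound_of_kernel hd (hlev j) hM hδH
      (fun p b => hK j _ (pow_ne_zero _ P.cast_L_pos.ne') _ (pow_pos (eta_pos P (lev j)) _) p b)),
    rfl, rfl, rfl, HEq.rfl⟩

/-- **THE INDEX OF `BIJ85Claim73Closed` IS TOTAL, GIVEN ONLY [6I] PROPOSITION 1.2** by its tree name `B5.Prop12Printed` for the torus
carriers `settingOf (torusRep P (lev j) (deltaAData …)) j` (`BIJ85Ineq722DeltaA.ineq722_deltaA_of_prop12Printed`).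
[cite: BalabanImbrieJaffe1985, (7.3.2) p.326] -/
theorem closedIdx_total_of_prop12Printed (hd : 2 ≤ P.d) {lev : ℕ → ℕ} (hlev : ∀ j, lev j ≤ P.m + P.K) {a : ℝ} (ha : 0 < a)
    (h12 : B5.Prop12Printed (fun j => settingOf (torusRep P (lev j) (deltaAData (hlev j) a)) j)) (pexp : ℝ) :
    ∃ KR : ℝ, 1 ≤ KR ∧ ∀ (j : ℕ), 1 ≤ lev j → ∀ (e : ℝ) (he : 0 < e) (he1 : e ≤ 1)
      (hsmall : e * (1 + Real.log e⁻¹) ^ pexp ≤ 1 / 2) (v : U1Field P (lev j)),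
      ∃ i : ClosedIdx P.d KR pexp, i.P = P ∧ i.k = lev j ∧ i.e = e ∧ HEq i.v v :=
  closedIdx_total_of_ineq722 hd hlev ha
    (ineq722_deltaA_of_prop12Printed lev hlev ha (fun _ => PUnit) (fun _ _ _ => 0) (fun _ _ _ _ _ => 0) (fun _ _ _ => 0) h12) pexp

end

end Literature.MathematicalPhysics.QuantumFieldTheory.BalabanImbrieJaffe1984to88.BIJ85ResidualSupBound
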